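import Mathlib
import HarnessLib

/-!
# Route `UnthreadedRigidityDoor`, wall item W2 `UnthreadedRigidity` (stmt-NavierStokesRegularity-27585) — LINE g12-2 «PERSISTENCE FILTER»
# (ns-idea-6 g12, `Persistence_sketch.lean` 09bc8f71301208c4): the MERIDIAN ODE ELIMINATION for the support S–M «SPHERE LAW»

Seat ns-es-p1 g9.  Pure one-variable calculus, no geometry: the meridian profile `f(θ) = Y(cos θ·a + sin θ·b)` of a ZONAL solid harmonic of
degree `l` satisfies the LEGENDRE RELATION `sin θ·f″ + cos θ·f′ + l(l+1) sin θ·f = 0` and `|∇Y|² = f′² + l²f²` along the meridian (tree,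
`…PersistenceGradSqAffineMeridian`).  If moreover `Y² = p|∇Y|² + qY + c₀` on `S²` (what a non-vanishing balance amplitude `b_l[H](r) ≠ 0` would force,
see `…PersistenceSphereLaw`), then `f² = p(f′² + l²f²) + qf + c₀`.  THIS FILE: these two relations with `p ≠ 0` and `f ≢ 0` force
`p < 0`, `q = 0`, `c₀ = 0` (`meridian_ode_elimination`) — so `Y² = p|∇Y|² ≤ 0` and `Y ≡ 0`, the contradiction that kills `b_l`.

ELIMINATION (on an interval `J₀` where `f′ ≠ 0`, `cos θ ≠ 0`; one exists since `f′ ≡ 0` would make `f` constant and Legendre at `π/2` would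
give `f ≡ 0`): with `A = (1 − pl²)/p`, `B = −q/(2p)`, `E₀ = −c₀/p`, `L = l(l+1)`, `M = A + L`:
(E1′) `f′² = Af² + 2Bf + E₀`; its derivative gives `f″ = Af + B` on `J₀`; Legendre becomes (E4) `cos θ·f′ = −sin θ·(Mf + B)`; the derivative
of (E4) is (E5) `cos θ·((A+M)f + 2B) = (1−M) sin θ·f′`; eliminating `θ` between (E4), (E5): (E7) `(M−1)f′² = (Mf + B)((A+M)f + 2B)`; with (E1′)
this is `u f² + v f + w = 0`, `u = M² + A`, `v = B(2 + A + M)`, `w = 2B² + (1−M)E₀`; two more derivatives (`f′ ≠ 0`) give `u = v = w = 0`.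
Then `M² = −A = L − M` ⇒ `M ∈ {l, −l−1}`; `M = l` ⇒ `A = −l²` ⇒ `Ap = 1 − pl²` is `0 = 1`; `M = −l−1` ⇒ `p = −1/(2l+1) < 0`, and `v = 0`, `w = 0`
give `B = 0`, `E₀ = 0`, i.e. `q = 0`, `c₀ = 0`.

HONEST LABEL: calculus helper for a support of a files-only RUNG line; nothing here bears on `UnthreadedRigidity` (27585), W2 or NS regularity.  0 kit.
[folklore]
-/

noncomputable section

-- the summit and its single sub-problem share the name (CONVENTIONS §1), as in every Theorems file
set_option linter.dupNamespace false

namespace Summit.NavierStokesRegularity.NavierStokesRegularity.Theorems.UnthreadedRigidity.Persistence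

open Set Function Filter Topology

/-- An identity holding on a neighbourhood can be differentiated: if `Φ = 0` near `θ` and `HasDerivAt Φ d θ` then `d = 0`. [folklore] -/
theorem deriv_eq_zero_of_eventuallyEq_zero {Φ : ℝ → ℝ} {d θ : ℝ} (hΦ : HasDerivAt Φ d θ) (h0 : ∀ᶠ s in 𝓝 θ, Φ s = 0) : d = 0 := by
  have h1 : HasDerivAt Φ 0 θ := (hasDerivAt_const θ (0 : ℝ)).congr_of_eventuallyEq h0
  exact hΦ.unique h1

/-- derivative of a square. [folklore] -/
theorem hasDerivAt_sq' {g : ℝ → ℝ} {g' θ : ℝ} (h : HasDerivAt g g' θ) : HasDerivAt (fun s => g s ^ 2) (2 * g θ * g') θ :=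
  (h.fun_pow 2).congr_deriv (by norm_num)

/-- ★ THE MERIDIAN ODE ELIMINATION (module docstring): `f² = p(f′² + l²f²) + qf + c₀` and the Legendre relation
`sin θ·f″ + cos θ·f′ + l(l+1) sin θ·f = 0` for a `C²` function `f ≢ 0` with `p ≠ 0`, `l ≥ 1`, force `p < 0`, `q = 0`, `c₀ = 0`. [folklore] -/
theorem meridian_ode_elimination {l : ℕ} (hl : 1 ≤ l) {p q c₀ : ℝ} (hp : p ≠ 0) {f fd fdd : ℝ → ℝ}
    (hf : ∀ θ, HasDerivAt f (fd θ) θ) (hfd : ∀ θ, HasDerivAt fd (fdd θ) θ)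
    (hE1 : ∀ θ, f θ ^ 2 = p * (fd θ ^ 2 + (l : ℝ) ^ 2 * f θ ^ 2) + q * f θ + c₀)
    (hE2 : ∀ θ, Real.sin θ * fdd θ + Real.cos θ * fd θ + (l : ℝ) * ((l : ℝ) + 1) * Real.sin θ * f θ = 0)
    (hne : ∃ θ₁, f θ₁ ≠ 0) : p < 0 ∧ q = 0 ∧ c₀ = 0 := by
  obtain ⟨θ₁, hθ₁⟩ := hne
  have hL : (0 : ℝ) < (l : ℝ) * ((l : ℝ) + 1) := by
    have : (1 : ℝ) ≤ (l : ℝ) := by exact_mod_cast hl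
    positivity
  -- constants
  set A : ℝ := (1 - p * (l : ℝ) ^ 2) / p with hA
  set B : ℝ := -q / (2 * p) with hB
  set E₀ : ℝ := -c₀ / p with hE₀
  set L : ℝ := (l : ℝ) * ((l : ℝ) + 1) with hLdef
  set M : ℝ := A + L with hM
  have hAp : A * p = 1 - p * (l : ℝ) ^ 2 := by rw [hA]; field_simp
  have hBp : q = -2 * p * B := by rw [hB]; field_simp
  have hEp : c₀ = -p * E₀ := by rw [hE₀]; field_simp
  -- (E1′): `fd² = A f² + 2B f + E₀`
  have hE1' : ∀ θ, fd θ ^ 2 = A * f θ ^ 2 + 2 * B * f θ + E₀ := by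
    intro θ
    have h := hE1 θ
    have key : p * (A * f θ ^ 2 + 2 * B * f θ + E₀) = (A * p) * f θ ^ 2 - (-2 * p * B) * f θ - (-p * E₀) := by ring
    rw [hAp, ← hBp, ← hEp] at key
    have h3 : p * fd θ ^ 2 = p * (A * f θ ^ 2 + 2 * B * f θ + E₀) := by
      rw [key]
      linear_combination (-1 : ℝ) * h
    exact mul_left_cancel₀ hp h3
  -- Step 1: `fd` does not vanish identically
  have hfd0 : ∃ θ₀, fd θ₀ ≠ 0 := by
    by_contra hcon
    push Not at hcon
    have hdf : Differentiable ℝ f := fun θ => (hf θ).differentiableAt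
    have hconst : ∀ θ, f θ = f θ₁ := fun θ =>
      is_const_of_deriv_eq_zero hdf (fun s => by rw [(hf s).deriv, hcon s]) θ θ₁
    -- `fdd ≡ 0`
    have hfdd0 : fdd (Real.pi / 2) = 0 := by
      have h1 : HasDerivAt fd 0 (Real.pi / 2) := by
        have : fd = fun _ => (0 : ℝ) := funext hcon
        rw [this]; exact hasDerivAt_const _ _
      exact (hfd _).unique h1
    have h := hE2 (Real.pi / 2)
    rw [Real.sin_pi_div_two, Real.cos_pi_div_two, hfdd0, hcon, hconst] at h
    have h' : L * f θ₁ = 0 := by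
      rw [hLdef]
      linear_combination h
    exact hθ₁ ((mul_eq_zero.1 h').resolve_left hL.ne')
  obtain ⟨θ₀, hθ₀⟩ := hfd0
  -- Step 2: an interval `J₀ = (θc − ε, θc + ε)` on which `fd ≠ 0` and `cos ≠ 0`
  obtain ⟨θc, hθc, hcosc⟩ : ∃ θc, fd θc ≠ 0 ∧ Real.cos θc ≠ 0 := by
    by_cases hc : Real.cos θ₀ ≠ 0
    · exact ⟨θ₀, hθ₀, hc⟩
    · push Not at hc
      -- move a little: `fd ≠ 0` near `θ₀`, and `cos (θ₀ + δ) = -sin θ₀ sin δ ≠ 0` for small `δ ∈ (0, π)`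
      have hev : ∀ᶠ θ in 𝓝 θ₀, fd θ ≠ 0 := (hfd θ₀).continuousAt.eventually_ne hθ₀
      obtain ⟨ε, hε, hball⟩ := Metric.eventually_nhds_iff.1 hev
      have hsin : Real.sin θ₀ ≠ 0 := by
        intro hs
        have := Real.sin_sq_add_cos_sq θ₀
        rw [hs, hc] at this
        norm_num at this
      set δ : ℝ := min (ε / 2) 1 with hδ
      have hδpos : 0 < δ := lt_min (by linarith) one_pos
      have hδε : δ < ε := lt_of_le_of_lt (min_le_left _ _) (by linarith)
      have hδπ : δ < Real.pi := lt_of_le_of_lt (min_le_right _ _) (by linarith [Real.pi_gt_three])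
      refine ⟨θ₀ + δ, hball (by rw [Real.dist_eq]; simp [abs_of_pos hδpos, hδε]), ?_⟩
      rw [Real.cos_add, hc, zero_mul, zero_sub, neg_ne_zero]
      exact mul_ne_zero hsin (Real.sin_pos_of_pos_of_lt_pi hδpos hδπ).ne'
  have hevJ : ∀ᶠ θ in 𝓝 θc, fd θ ≠ 0 ∧ Real.cos θ ≠ 0 :=
    ((hfd θc).continuousAt.eventually_ne hθc).and (Real.continuous_cos.continuousAt.eventually_ne hcosc)
  obtain ⟨ε, hε, hJ⟩ := Metric.eventually_nhds_iff.1 hevJ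
  -- notation: `J₀ = ball θc ε`; every point of it has a neighbourhood inside it
  have hJnhds : ∀ θ, dist θ θc < ε → ∀ᶠ s in 𝓝 θ, dist s θc < ε := fun θ hθ =>
    Metric.isOpen_ball.mem_nhds (by rwa [Metric.mem_ball])
  -- Step 3: on `J₀`, `fdd = A f + B` (differentiate (E1′))
  have hE3 : ∀ θ, dist θ θc < ε → fdd θ = A * f θ + B := by
    intro θ hθ
    have h1 : HasDerivAt (fun s => fd s ^ 2) (2 * fd θ * fdd θ) θ := hasDerivAt_sq' (hfd θ)
    have h2 : HasDerivAt (fun s => A * f s ^ 2 + 2 * B * f s + E₀) (A * (2 * f θ * fd θ) + 2 * B * fd θ) θ :=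
      (((hasDerivAt_sq' (hf θ)).const_mul A).add ((hf θ).const_mul (2 * B))).add_const E₀
    have heq : (fun s => fd s ^ 2) = fun s => A * f s ^ 2 + 2 * B * f s + E₀ := funext hE1'
    rw [heq] at h1
    have h3 : 2 * fd θ * fdd θ = A * (2 * f θ * fd θ) + 2 * B * fd θ := h1.unique h2
    have h4 : fd θ * (fdd θ - (A * f θ + B)) = 0 := by linear_combination h3 / 2
    rcases mul_eq_zero.1 h4 with h5 | h5
    · exact absurd h5 (hJ hθ).1
    · linarith
  -- Step 4: on `J₀`, (E4) `cos θ·fd = −sin θ·(M f + B)`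
  have hE4 : ∀ θ, dist θ θc < ε → Real.cos θ * fd θ + Real.sin θ * (M * f θ + B) = 0 := by
    intro θ hθ
    have h := hE2 θ
    rw [hE3 θ hθ] at h
    rw [hM, hLdef]
    linear_combination h
  -- Step 5: on `J₀`, (E5) `cos θ·((A+M) f + 2B) = (1−M) sin θ·fd` (differentiate (E4))
  have hE5 : ∀ θ, dist θ θc < ε → Real.cos θ * ((A + M) * f θ + 2 * B) - (1 - M) * Real.sin θ * fd θ = 0 := by
    intro θ hθ
    have hΦ : HasDerivAt (fun s => Real.cos s * fd s + Real.sin s * (M * f s + B))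
        (-Real.sin θ * fd θ + Real.cos θ * fdd θ + (Real.cos θ * (M * f θ + B) + Real.sin θ * (M * fd θ))) θ := by
      have h1 : HasDerivAt (fun s => Real.cos s * fd s) (-Real.sin θ * fd θ + Real.cos θ * fdd θ) θ :=
        (Real.hasDerivAt_cos θ).mul (hfd θ)
      have h2 : HasDerivAt (fun s => M * f s + B) (M * fd θ) θ := by
        have := ((hf θ).const_mul M).add_const B
        simpa using this
      have h3 : HasDerivAt (fun s => Real.sin s * (M * f s + B)) (Real.cos θ * (M * f θ + B) + Real.sin θ * (M * fd θ)) θ :=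
        (Real.hasDerivAt_sin θ).mul h2
      exact h1.add h3
    have h0 : ∀ᶠ s in 𝓝 θ, Real.cos s * fd s + Real.sin s * (M * f s + B) = 0 :=
      (hJnhds θ hθ).mono fun s hs => hE4 s hs
    have hd := deriv_eq_zero_of_eventuallyEq_zero hΦ h0
    rw [hE3 θ hθ] at hd
    rw [hM] at hd ⊢
    linear_combination hd
  -- Step 6: eliminate `θ`: (E7) `(M−1) fd² = (M f + B)((A+M) f + 2B)` on `J₀`, hence `u f² + v f + w = 0`
  have hquad : ∀ θ, dist θ θc < ε →
      (M ^ 2 + A) * f θ ^ 2 + B * (2 + A + M) * f θ + (2 * B ^ 2 + (1 - M) * E₀) = 0 := by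
    intro θ hθ
    have h4 := hE4 θ hθ
    have h5 := hE5 θ hθ
    have hc := (hJ hθ).2
    -- `cos θ · [(M−1) fd² − (Mf+B)((A+M)f+2B)] = 0`
    have h7 : Real.cos θ * ((M - 1) * fd θ ^ 2 - (M * f θ + B) * ((A + M) * f θ + 2 * B)) = 0 := by
      linear_combination ((M - 1) * fd θ) * h4 - (M * f θ + B) * h5
    have h8 : (M - 1) * fd θ ^ 2 - (M * f θ + B) * ((A + M) * f θ + 2 * B) = 0 := (mul_eq_zero.1 h7).resolve_left hc
    rw [hE1' θ] at h8
    linear_combination -h8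
  -- Step 7: two derivatives kill the coefficients
  set u : ℝ := M ^ 2 + A with hu
  set v : ℝ := B * (2 + A + M) with hv
  set w : ℝ := 2 * B ^ 2 + (1 - M) * E₀ with hw
  have hlin : ∀ θ, dist θ θc < ε → 2 * u * f θ + v = 0 := by
    intro θ hθ
    have hΦ : HasDerivAt (fun s => u * f s ^ 2 + v * f s + w) (u * (2 * f θ * fd θ) + v * fd θ) θ :=
      (((hasDerivAt_sq' (hf θ)).const_mul u).add ((hf θ).const_mul v)).add_const w
    have h0 : ∀ᶠ s in 𝓝 θ, u * f s ^ 2 + v * f s + w = 0 := (hJnhds θ hθ).mono fun s hs => hquad s hs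
    have hd := deriv_eq_zero_of_eventuallyEq_zero hΦ h0
    have h1 : fd θ * (2 * u * f θ + v) = 0 := by linear_combination hd
    exact (mul_eq_zero.1 h1).resolve_left (hJ hθ).1
  have hu0 : u = 0 := by
    have hΦ : HasDerivAt (fun s => 2 * u * f s + v) (2 * u * fd θc) θc := by
      have := ((hf θc).const_mul (2 * u)).add_const v
      simpa using this
    have h0 : ∀ᶠ s in 𝓝 θc, 2 * u * f s + v = 0 := (hJnhds θc (by simp [hε])).mono fun s hs => hlin s hs
    have hd := deriv_eq_zero_of_eventuallyEq_zero hΦ h0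
    have h1 : u * fd θc = 0 := by linear_combination hd / 2
    exact (mul_eq_zero.1 h1).resolve_right hθc
  have hv0 : v = 0 := by
    have h := hlin θc (by simp [hε])
    rw [hu0] at h
    linarith
  have hw0 : w = 0 := by
    have h := hquad θc (by simp [hε])
    rw [hu0, hv0] at h
    linarith
  -- Step 8: arithmetic
  have hM2 : (M - (l : ℝ)) * (M + (l : ℝ) + 1) = 0 := by
    have h1 : M ^ 2 + A = 0 := by rw [← hu]; exact hu0
    have h2 : M = A + L := hM
    rw [hLdef] at h2
    nlinarith [h1, h2]
  rcases mul_eq_zero.1 hM2 with hMl | hMl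
  · -- `M = l`: `A = −l²` contradicts `A p = 1 − p l²`
    exfalso
    have hA' : A = -(l : ℝ) ^ 2 := by
      have h1 : M ^ 2 + A = 0 := by rw [← hu]; exact hu0
      have : M = (l : ℝ) := by linarith
      rw [this] at h1
      linarith
    rw [hA'] at hAp
    nlinarith [hAp]
  · -- `M = −(l+1)`: `p = −1/(2l+1) < 0`, `B = 0`, `E₀ = 0`
    have hMv : M = -((l : ℝ) + 1) := by linarith
    have hA' : A = -((l : ℝ) + 1) ^ 2 := by
      have h1 : M ^ 2 + A = 0 := by rw [← hu]; exact hu0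
      rw [hMv] at h1
      linarith
    have hp' : p * (2 * (l : ℝ) + 1) = -1 := by
      rw [hA'] at hAp
      linear_combination (-1 : ℝ) * hAp
    have hl0 : (0 : ℝ) ≤ (l : ℝ) := by positivity
    have hpneg : p < 0 := by nlinarith [hp', hl0]
    have hB0 : B = 0 := by
      have h : B * (2 + A + M) = 0 := by rw [← hv]; exact hv0
      have hcoef : 2 + A + M ≠ 0 := by
        rw [hA', hMv]
        nlinarith [hl0]
      exact (mul_eq_zero.1 h).resolve_right hcoef
    have hE00 : E₀ = 0 := by
      have h : 2 * B ^ 2 + (1 - M) * E₀ = 0 := by rw [← hw]; exact hw0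
      rw [hB0, hMv] at h
      have hcoef : (1 + ((l : ℝ) + 1)) ≠ 0 := by positivity
      have h' : (1 + ((l : ℝ) + 1)) * E₀ = 0 := by linear_combination h
      exact (mul_eq_zero.1 h').resolve_left hcoef
    refine ⟨hpneg, ?_, ?_⟩
    · rw [hBp, hB0, mul_zero]
    · rw [hEp, hE00, mul_zero]

/-- ★ THE MERIDIAN CONTRADICTION, any `p`: `f² = p(f′² + l²f²) + qf + c₀` and the Legendre relation for a `C²` function with `f(θ₁) ≠ 0`,
`l ≥ 1`, are INCOMPATIBLE.  (`p ≠ 0`: by `meridian_ode_elimination`, `p < 0` and `q = c₀ = 0`, so `f(θ₁)² = p(f′² + l²f²) ≤ 0`; `p = 0`: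
`(2f − q)f′ = 0`, so where `f′ ≠ 0` the function `f` is locally constant — absurd — hence `f′ ≡ 0`, `f` is constant, `f″ ≡ 0`, and Legendre at
`π/2` gives `f ≡ 0`.) [folklore] -/
theorem meridian_ode_contradiction {l : ℕ} (hl : 1 ≤ l) {p q c₀ : ℝ} {f fd fdd : ℝ → ℝ}
    (hf : ∀ θ, HasDerivAt f (fd θ) θ) (hfd : ∀ θ, HasDerivAt fd (fdd θ) θ)
    (hE1 : ∀ θ, f θ ^ 2 = p * (fd θ ^ 2 + (l : ℝ) ^ 2 * f θ ^ 2) + q * f θ + c₀)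
    (hE2 : ∀ θ, Real.sin θ * fdd θ + Real.cos θ * fd θ + (l : ℝ) * ((l : ℝ) + 1) * Real.sin θ * f θ = 0)
    {θ₁ : ℝ} (hθ₁ : f θ₁ ≠ 0) : False := by
  by_cases hp : p = 0
  · -- `p = 0`: `f′ ≡ 0`
    have hfd0 : ∀ θ, fd θ = 0 := by
      intro θ
      by_contra hne
      -- near `θ`, `fd ≠ 0`, hence `2 f − q = 0`, hence `f` is constant near `θ` and `fd θ = 0`
      have hev : ∀ᶠ s in 𝓝 θ, fd s ≠ 0 := (hfd θ).continuousAt.eventually_ne hne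
      have hder : ∀ s, fd s * (2 * f s - q) = 0 := by
        intro s
        have h1 : HasDerivAt (fun t => f t ^ 2) (2 * f s * fd s) s := hasDerivAt_sq' (hf s)
        have h2 : HasDerivAt (fun t => q * f t + c₀) (q * fd s) s := ((hf s).const_mul q).add_const c₀
        have heq : (fun t => f t ^ 2) = fun t => q * f t + c₀ := by
          funext t
          have := hE1 t
          rw [hp] at this
          linear_combination this
        rw [heq] at h1
        have h3 := h1.unique h2
        linear_combination h3
      have hloc : ∀ᶠ s in 𝓝 θ, f s = q / 2 := hev.mono fun s hs => by
        have h := hder s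
        have h' : 2 * f s - q = 0 := (mul_eq_zero.1 h).resolve_left hs
        linarith
      have hzero : fd θ = 0 := by
        have h1 : HasDerivAt f 0 θ := (hasDerivAt_const θ (q / 2)).congr_of_eventuallyEq hloc
        exact (hf θ).unique h1
      exact hne hzero
    have hdf : Differentiable ℝ f := fun θ => (hf θ).differentiableAt
    have hconst : ∀ θ, f θ = f θ₁ := fun θ =>
      is_const_of_deriv_eq_zero hdf (fun s => by rw [(hf s).deriv, hfd0 s]) θ θ₁
    have hfdd0 : fdd (Real.pi / 2) = 0 := by
      have h1 : HasDerivAt fd 0 (Real.pi / 2) := by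
        have : fd = fun _ => (0 : ℝ) := funext hfd0
        rw [this]; exact hasDerivAt_const _ _
      exact (hfd _).unique h1
    have hL : (0 : ℝ) < (l : ℝ) * ((l : ℝ) + 1) := by
      have : (1 : ℝ) ≤ (l : ℝ) := by exact_mod_cast hl
      positivity
    have h := hE2 (Real.pi / 2)
    rw [Real.sin_pi_div_two, Real.cos_pi_div_two, hfdd0, hfd0, hconst] at h
    have h' : ((l : ℝ) * ((l : ℝ) + 1)) * f θ₁ = 0 := by linear_combination h
    exact hθ₁ ((mul_eq_zero.1 h').resolve_left hL.ne')
  · obtain ⟨hpneg, hq, hc⟩ := meridian_ode_elimination hl hp hf hfd hE1 hE2 ⟨θ₁, hθ₁⟩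
    have h := hE1 θ₁
    rw [hq, hc] at h
    have hnn : 0 ≤ fd θ₁ ^ 2 + (l : ℝ) ^ 2 * f θ₁ ^ 2 := by positivity
    have hsq : 0 < f θ₁ ^ 2 := by positivity
    nlinarith [mul_nonpos_iff.2 (Or.inr ⟨hpneg.le, hnn⟩)]

end Summit.NavierStokesRegularity.NavierStokesRegularity.Theorems.UnthreadedRigidity.Persistence

end
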